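import Mathlib
import HarnessLib
import Summits.Langlands.Langlands.Theses.G2ShadowRankSeven

/-!
# Birth skeleton — crux `LineOrIrreducibleAdmissible` (route `G2ShadowRankSeven`, item stmt-Langlands-18289)

BC3 skeleton (`Lines/birth.lean`). Three registered stubs and the kernel-checked composition
`LineOrIrreducibleAdmissible_of : LineOrIrreducibleAdmissible` (proof = stub₁, stub₂, stub₃ invoked BY NAME +
pure logic; the skeleton audit's layer invariant: no Prop hypotheses other than registered obligations).
The stub NAMES and SIGNATURES are verbatim those of the skeleton already registered on the
ledger for this item (sha e5ac3f1b790a, by planner-plan-lens3-Langlands-nearmiss-g3-0,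
vetted PASS by refuter-skel-stmt-Langlands-18289-vet-0: probes stub→crux / stub→Langlands
failed 42/42); this file is their publication as the crux workfile `Lines/birth.lean`.

Line (the route's own two-layer plan for B):
* `stub_semisimpleCompanionTransport` (M) — every Satake–Frobenius-compatible framed ℓ-adic
  avatar ρ of π has a SEMISIMPLE compatible companion ρ' (its semisimplification, re-framed:
  same characteristic polynomials of Frobenius, hence same compatibility) such that
  irreducibility of ρ' gives irreducibility of ρ (one Jordan–Hölder factor) and a line in ρ'
  gives a one-dimensional subquotient W'/W of ρ (a 1-dimensional JH factor sits as a step of a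
  composition series). Pure representation theory of profinite groups over a field; no
  exceptional set.
* `stub_lineOrIrreducibleOrFourThree` (L) — Dai's cells in G₂-admissible weight, for SEMISIMPLE
  compatible avatars, cofinitely in ℓ: irreducible, or a one-dimensional summand, or a 3 + 4
  direct-sum decomposition (the SO₄ ⊂ G₂ shape) — arXiv:2510.12496 §3–4 re-run on the admissible
  locus (7A₁ / B₃ / induced types give a line or irreducibility; the only line-free reducible
  semisimple shape with G₂ formal bi-character left is 3 + 4).
* `stub_noFourThreeSplit` (L) — cofinitely in ℓ no semisimple compatible avatar splits 3 + 4
  with trivial intersection: the 3 is odd essentially self-dual of type SO₃ (Calegari–Gee),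
  fits a compatible system (Hui 2023), and Goursat on G₂ × SO₃ raises the semisimple rank at a
  Lie-irreducible λ₀, contradicting Serre–Hui λ-independence (doi:10.1112/jlms.12811,
  arXiv:1104.4827, doi:10.4310/MRL.2013.v20.n4.a8).

Composition: S = S₂ ∪ S₃; for ℓ ∉ S pass from ρ to its semisimple companion ρ', run stub₂ on ρ',
kill the third disjunct with stub₃, and transport the first two back to ρ with stub₁.
-/

namespace Summit.Langlands.Langlands.Cruxes.LineOrIrreducibleAdmissible.Birth

open Literature.NumberTheory.Automorphic Literature.NumberTheory.GaloisRepresentations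
open IsDedekindDomain NumberField
open scoped NumberField
open Summit.Langlands.Langlands.Theses.G2ShadowRankSeven

/-- stub (M): semisimple companion with transport of irreducibility / lines back to ρ. -/
theorem stub_semisimpleCompanionTransport : ∀ (hcpt : isCompact_glFiniteIntegralLevel 7 ℚ) (π : CuspidalAutomorphicRepData 7 ℚ hcpt), ∀ (ℓ : ℕ) [Fact ℓ.Prime] (ι : PadicAlgCl ℓ ≃+* ℂ) (ρ : FramedGaloisRep ℚ (PadicAlgCl ℓ) 7), (∀ᶠ v : HeightOneSpectrum (𝓞 ℚ) in Filter.cofinite, Summit.Langlands.SatakeFrobCompatibleAt ι π.1 ρ v) → ∃ ρ' : FramedGaloisRep ℚ (PadicAlgCl ℓ) 7, (∀ᶠ v : HeightOneSpectrum (𝓞 ℚ) in Filter.cofinite, Summit.Langlands.SatakeFrobCompatibleAt ι π.1 ρ' v) ∧ ρ'.toGaloisRep.IsSemisimple ∧ (ρ'.toGaloisRep.IsIrreducible → ρ.toGaloisRep.IsIrreducible) ∧ ((∃ W : Subrepresentation ρ'.toGaloisRep.toRepresentation, Module.finrank (PadicAlgCl ℓ) W.toSubmodule = 1) → (∃ W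 W' : Subrepresentation ρ.toGaloisRep.toRepresentation, W' < W ∧ Module.finrank (PadicAlgCl ℓ) W.toSubmodule = Module.finrank (PadicAlgCl ℓ) W'.toSubmodule + 1)) := by
  sorry

/-- stub (L): Dai's cells on the G₂-admissible locus for semisimple compatible avatars:
irreducible ∨ a line ∨ a 3 + 4 splitting. -/
theorem stub_lineOrIrreducibleOrFourThree : ∀ (hcpt : isCompact_glFiniteIntegralLevel 7 ℚ) (π : CuspidalAutomorphicRepData 7 ℚ hcpt) (T : InfinityType ℚ 7), π.1.HasInfinityType T → T.IsRegular → T.IsLAlgebraic → (∃ (h1 : isCompact_glFiniteIntegralLevel 1 ℚ) (η : CuspidalAutomorphicRepData 1 ℚ h1), ∀ᶠ v : HeightOneSpectrum (𝓞 ℚ) in Filter.cofinite, ∀ α : Multiset ℂ, π.1.HasSatakeParamAt v α → ∃ e : ℂ, η.1.HasSatakeParamAt v {e} ∧ α.map (fun a => a⁻¹) = α.map (fun a => e * a)) → (∀ σ : ℚ →+* ℂ, ∃ c p q : ℂ, (T σ).map ArchWeight.a = {c, c + p, c - p, c + q, c - q, c + (p + q), c - (p + q)}) → ∃ S : Finset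 ℕ, ∀ (ℓ : ℕ) [Fact ℓ.Prime], ℓ ∉ S → ∀ (ι : PadicAlgCl ℓ ≃+* ℂ) (ρ : FramedGaloisRep ℚ (PadicAlgCl ℓ) 7), (∀ᶠ v : HeightOneSpectrum (𝓞 ℚ) in Filter.cofinite, Summit.Langlands.SatakeFrobCompatibleAt ι π.1 ρ v) → ρ.toGaloisRep.IsSemisimple → ρ.toGaloisRep.IsIrreducible ∨ (∃ W : Subrepresentation ρ.toGaloisRep.toRepresentation, Module.finrank (PadicAlgCl ℓ) W.toSubmodule = 1) ∨ (∃ W W' : Subrepresentation ρ.toGaloisRep.toRepresentation, Module.finrank (PadicAlgCl ℓ) W.toSubmodule = 3 ∧ Module.finrank (PadicAlgCl ℓ) W'.toSubmodule = 4 ∧ W ⊓ W' = ⊥) := by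
  sorry

/-- stub (L): Goursat on G₂ × SO₃ + Serre–Hui λ-independence: no 3 + 4 splitting cofinitely. -/
theorem stub_noFourThreeSplit : ∀ (hcpt : isCompact_glFiniteIntegralLevel 7 ℚ) (π : CuspidalAutomorphicRepData 7 ℚ hcpt) (T : InfinityType ℚ 7), π.1.HasInfinityType T → T.IsRegular → T.IsLAlgebraic → (∃ (h1 : isCompact_glFiniteIntegralLevel 1 ℚ) (η : CuspidalAutomorphicRepData 1 ℚ h1), ∀ᶠ v : HeightOneSpectrum (𝓞 ℚ) in Filter.cofinite, ∀ α : Multiset ℂ, π.1.HasSatakeParamAt v α → ∃ e : ℂ, η.1.HasSatakeParamAt v {e} ∧ α.map (fun a => a⁻¹) = α.map (fun a => e * a)) → (∀ σ : ℚ →+* ℂ, ∃ c p q : ℂ, (T σ).map ArchWeight.a = {c, c + p, c - p, c + q, c - q, c + (p + q), c - (p + q)}) → ∃ S : Finset ℕ, ∀ (ℓ : ℕ) [Fact ℓ.Prime], ℓ ∉ S → ∀ (ι : PadicAlgCl ℓ ≃+* ℂ) (ρ : FramedGaloisRep ℚ (PadicAlgCl ℓ) 7), (∀ᶠ v : HeightOneSpectrum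 (𝓞 ℚ) in Filter.cofinite, Summit.Langlands.SatakeFrobCompatibleAt ι π.1 ρ v) → ρ.toGaloisRep.IsSemisimple → ¬ (∃ W W' : Subrepresentation ρ.toGaloisRep.toRepresentation, Module.finrank (PadicAlgCl ℓ) W.toSubmodule = 3 ∧ Module.finrank (PadicAlgCl ℓ) W'.toSubmodule = 4 ∧ W ⊓ W' = ⊥) := by
  sorry

/-- The kernel-checked composition: the crux BY NAME from the three declared stubs (invoked by name;
no `sorry` in this proof — the only `sorry`s of the file are the three `stub_*` bodies). The same
composition with the stub statements as explicit hypotheses (sorry-free axiom closure) is kept in the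
registrar's folder as `bc/birth_imp.lean` (lean check rc 0). -/
theorem LineOrIrreducibleAdmissible_of :
    Summit.Langlands.Langlands.Theses.G2ShadowRankSeven.LineOrIrreducibleAdmissible := by
  intro hcpt π T hT hreg halg hsd hadm
  obtain ⟨S2, hS2⟩ := stub_lineOrIrreducibleOrFourThree hcpt π T hT hreg halg hsd hadm
  obtain ⟨S3, hS3⟩ := stub_noFourThreeSplit hcpt π T hT hreg halg hsd hadm
  refine ⟨S2 ∪ S3, ?_⟩
  intro ℓ _ hℓ ι ρ hρ
  have hℓ2 : ℓ ∉ S2 := fun h => hℓ (Finset.mem_union_left _ h)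
  have hℓ3 : ℓ ∉ S3 := fun h => hℓ (Finset.mem_union_right _ h)
  -- pass to the semisimple companion ρ' of ρ (stub 1), run the trichotomy (stub 2) on ρ',
  -- kill the 3 + 4 splitting (stub 3), and transport irreducibility / the line back to ρ.
  obtain ⟨ρ', hρ', hss, hirr, hline⟩ := stub_semisimpleCompanionTransport hcpt π ℓ ι ρ hρ
  rcases hS2 ℓ hℓ2 ι ρ' hρ' hss with h | h | h
  · exact Or.inl (hirr h)
  · exact Or.inr (hline h)
  · exact absurd h (hS3 ℓ hℓ3 ι ρ' hρ' hss)

end Summit.Langlands.Langlands.Cruxes.LineOrIrreducibleAdmissible.Birth
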